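import Summits.FinalStateConjecture.FinalStateConjecture.Theorems.KillingSpinorEndgame.Negative.LatenessTransport
import Summits.FinalStateConjecture.FinalStateConjecture.Theorems.NecksCertify.Negative.NecksCertifyFalseOfEqualVelocityBinaryWitness

/-!
# `KillingSpinorEndgame` (crux `stmt-FinalStateConjecture-17645`, route KerrnessPropagates, rank 2) —
# negative-side lemma II: "beyond every lab time τ₁" is decoration for comoving configurations
# (in particular `N = 0` and `N = 1`)

Refuter seat `refuter-rattack-stmt-FinalStateConjecture-17645-0` (crux attack / vetting, 2026-08-17).
Kernel-checked, `sorry`-free, no definitions, no named facts; nothing here closes the item.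
Continuation of `Negative/LatenessTransport.lean` (`slab_translate`: an `ε`-good slab of clause (i)
at lab time `τ` translates to lab time `τ − w⁰` along any common Killing translation `w` of the
configuration). Here: scaling `w`, ONE `ε`-good slab yields an `ε`-good slab at EVERY lab time
(`slab_anytime`); hence for comoving configurations the lateness quantifier `∀ τ₁, ∃ τ ≥ τ₁` of
clause (i) of the crux (and of `KerrBasinCapture`, `SingleKerrEndgame`) is equivalent to a bare
`∃ τ` (`recurs_iff_exists_slab`; `recurs_iff_exists_slab_of_eq` for holes sharing one Lorentz part,
which covers `N = 0` and `N = 1` via `(Λ∂₀)⁰ ≠ 0`, the landed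
`NecksCertify.Negative.lorentz_basisVector_zero_apply_zero_ne_zero`); and BY
NAME the crux already decides every comoving-recurrent development with no lateness at all
(`killingSpinorEndgame_comoving_anytime`). "Recurrence at arbitrarily late times" carries, as
typed, no more information than "for every `ε` some `ε`-good slab somewhere in `J⁺(ιX)`": a prover
cannot use lateness of the handed-over slabs (it must be re-derived intrinsically, e.g. from
`range Φ ⊆ J⁺(ιX)` and a limiting argument), and a planner wanting the intended meaning must anchor
`τ` intrinsically (e.g. slab `⊆ I⁺` of the previous slab, or of a fixed exhaustion of `M`). For
`N ≥ 2` holes with pairwise distinct 4-velocities no common `w` exists (separations `∝ τ`) and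
nothing is claimed.

## References

* R. P. Kerr, A. Schild (1965), §2 (stationarity and Lorentz covariance of the Kerr–Schild form).
* B. O'Neill, *Semi-Riemannian Geometry* (1983), Ch. 9, pp. 233–236 (Lorentz and Poincaré maps).
* M. Dafermos, G. Holzegel, I. Rodnianski, M. Taylor, arXiv:2104.08222, §1 (charts, `Cᵏ` deviations).
-/

noncomputable section

-- the doubled `FinalStateConjecture.FinalStateConjecture` path component trips dupNamespace
set_option linter.dupNamespace false

open Bundle TopologicalSpace Set Function Filter
open scoped Manifold ContDiff Topology ENNReal

namespace Summit.FinalStateConjecture.FinalStateConjecture.Theorems.KillingSpinorEndgame.Negative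

open Literature.Geometry.Lorentzian

section Consequences

variable {X : Type} [TopologicalSpace X] [ChartedSpace E3 X] [IsManifold (𝓡 3) ∞ X]
  [ConnectedSpace X] {D : InitialDataSet (𝓡 3) X}

/-! ### Consequences: one good slab gives a good slab at every lab time -/

/-- **One `ε`-good slab yields an `ε`-good slab at EVERY lab time**, for a configuration with a
common Killing translation `w` (`Λⱼ⁻¹ w ∈ ℝ∂₀` for all `j`) of non-zero lab-time component `w⁰ ≠ 0`:
translate by the multiple `((τ − τ′)/w⁰) w` (`slab_translate`). [cite: KerrSchild1965, §2] -/
theorem slab_anytime (𝒟 : VacuumCauchyDevelopment D) (k N : ℕ) (M a r₀ : Fin N → ℝ)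
    (mo : Fin N → ↥lorentzGroup × E4) (w : E4) (s : Fin N → ℝ)
    (hw : ∀ j, ((mo j).1 : E4 ≃L[ℝ] E4).symm w = s j • E4.basisVector 0) (hw0 : w 0 ≠ 0)
    (ε τ τ' : ℝ)
    (h : ∃ (R : Fin N → ℝ) (U : Opens E4) (Φ : U → 𝒟.carrier), (∀ i, r₀ i + 1 ≤ R i) ∧
        ContMDiff 𝓘(ℝ, E4) (𝓡 4) ∞ Φ ∧ Topology.IsOpenEmbedding Φ ∧
        {x : E4 | x 0 = τ ∧ ∀ j, r₀ j < Kerr.radius (a j) (poincareInv (mo j).1 (mo j).2 x)} ⊆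
          (U : Set E4) ∧
        range Φ ⊆ 𝒟.metric.causalFuture 𝒟.timeOrientation (range 𝒟.embed) ∧
        𝒟.metric.IsAchronal 𝒟.timeOrientation (Φ '' {x : ↥U | (x : E4) 0 = τ}) ∧
        (∀ i, supCkENorm {x : E4 | x 0 = τ ∧
            (∀ j, r₀ j < Kerr.radius (a j) (poincareInv (mo j).1 (mo j).2 x)) ∧
            Kerr.radius (a i) (poincareInv (mo i).1 (mo i).2 x) ≤ R i} k
          (𝒟.toSpacetime.deviationExtend ⟨U, boostedKerrBilin (mo i).1 (mo i).2 (M i) (a i),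
            fun x ↦ x 0, fun x ↦ Kerr.radius (a i) (poincareInv (mo i).1 (mo i).2 x)⟩ Φ) ≤
          ENNReal.ofReal ε) ∧
        supCkENorm {x : E4 | x 0 = τ ∧
            (∀ j, r₀ j < Kerr.radius (a j) (poincareInv (mo j).1 (mo j).2 x)) ∧
            ∀ j, R j - 1 ≤ Kerr.radius (a j) (poincareInv (mo j).1 (mo j).2 x)} k
          (𝒟.toSpacetime.deviationExtend (Minkowski.backgroundOn U) Φ) ≤ ENNReal.ofReal ε ∧
        (∀ x : ↥U, x.1 0 = τ →
          (∀ j, R j - 1 ≤ Kerr.radius (a j) (poincareInv (mo j).1 (mo j).2 x.1)) →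
          𝒟.timeOrientation.IsFutureDirected (mfderiv 𝓘(ℝ, E4) (𝓡 4) Φ x (E4.basisVector 0)))) :
    ∃ (R : Fin N → ℝ) (U : Opens E4) (Φ : U → 𝒟.carrier), (∀ i, r₀ i + 1 ≤ R i) ∧
      ContMDiff 𝓘(ℝ, E4) (𝓡 4) ∞ Φ ∧ Topology.IsOpenEmbedding Φ ∧
      {x : E4 | x 0 = τ' ∧ ∀ j, r₀ j < Kerr.radius (a j) (poincareInv (mo j).1 (mo j).2 x)} ⊆
        (U : Set E4) ∧
      range Φ ⊆ 𝒟.metric.causalFuture 𝒟.timeOrientation (range 𝒟.embed) ∧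
      𝒟.metric.IsAchronal 𝒟.timeOrientation (Φ '' {x : ↥U | (x : E4) 0 = τ'}) ∧
      (∀ i, supCkENorm {x : E4 | x 0 = τ' ∧
          (∀ j, r₀ j < Kerr.radius (a j) (poincareInv (mo j).1 (mo j).2 x)) ∧
          Kerr.radius (a i) (poincareInv (mo i).1 (mo i).2 x) ≤ R i} k
        (𝒟.toSpacetime.deviationExtend ⟨U, boostedKerrBilin (mo i).1 (mo i).2 (M i) (a i),
          fun x ↦ x 0, fun x ↦ Kerr.radius (a i) (poincareInv (mo i).1 (mo i).2 x)⟩ Φ) ≤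
        ENNReal.ofReal ε) ∧
      supCkENorm {x : E4 | x 0 = τ' ∧
          (∀ j, r₀ j < Kerr.radius (a j) (poincareInv (mo j).1 (mo j).2 x)) ∧
          ∀ j, R j - 1 ≤ Kerr.radius (a j) (poincareInv (mo j).1 (mo j).2 x)} k
        (𝒟.toSpacetime.deviationExtend (Minkowski.backgroundOn U) Φ) ≤ ENNReal.ofReal ε ∧
      (∀ x : ↥U, x.1 0 = τ' →
        (∀ j, R j - 1 ≤ Kerr.radius (a j) (poincareInv (mo j).1 (mo j).2 x.1)) →
        𝒟.timeOrientation.IsFutureDirected (mfderiv 𝓘(ℝ, E4) (𝓡 4) Φ x (E4.basisVector 0))) := by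
  set c : ℝ := (τ - τ') / w 0 with hc
  have hw' : ∀ j, ((mo j).1 : E4 ≃L[ℝ] E4).symm (c • w) = (c * s j) • E4.basisVector 0 :=
    fun j ↦ by rw [map_smul, hw j, smul_smul]
  have key := slab_translate 𝒟 k N M a r₀ mo (c • w) (fun j ↦ c * s j) hw' ε τ h
  have e : τ - (c • w) 0 = τ' := by
    rw [show (c • w) 0 = c * w 0 from rfl, hc, div_mul_cancel₀ _ hw0, sub_sub_cancel]
  rwa [e] at key

/-- **For comoving configurations the lateness quantifier of clause (i) is decoration**: with a
common Killing translation `w`, `w⁰ ≠ 0`, "for every `ε > 0` and every `τ₁` an `ε`-good slab at some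
lab time `τ ≥ τ₁`" is equivalent to "for every `ε > 0` an `ε`-good slab at some lab time" — the
recurrence clause of `KillingSpinorEndgame` / `KerrBasinCapture` carries, as typed, no lateness.
[cite: KerrSchild1965, §2] -/
theorem recurs_iff_exists_slab (𝒟 : VacuumCauchyDevelopment D) (k N : ℕ) (M a r₀ : Fin N → ℝ)
    (mo : Fin N → ↥lorentzGroup × E4) (w : E4) (s : Fin N → ℝ)
    (hw : ∀ j, ((mo j).1 : E4 ≃L[ℝ] E4).symm w = s j • E4.basisVector 0) (hw0 : w 0 ≠ 0) :
    (∀ ε : ℝ, 0 < ε → ∀ τ₁ : ℝ, ∃ τ : ℝ, τ₁ ≤ τ ∧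
      ∃ (R : Fin N → ℝ) (U : Opens E4) (Φ : U → 𝒟.carrier), (∀ i, r₀ i + 1 ≤ R i) ∧
        ContMDiff 𝓘(ℝ, E4) (𝓡 4) ∞ Φ ∧ Topology.IsOpenEmbedding Φ ∧
        {x : E4 | x 0 = τ ∧ ∀ j, r₀ j < Kerr.radius (a j) (poincareInv (mo j).1 (mo j).2 x)} ⊆
          (U : Set E4) ∧
        range Φ ⊆ 𝒟.metric.causalFuture 𝒟.timeOrientation (range 𝒟.embed) ∧
        𝒟.metric.IsAchronal 𝒟.timeOrientation (Φ '' {x : ↥U | (x : E4) 0 = τ}) ∧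
        (∀ i, supCkENorm {x : E4 | x 0 = τ ∧
            (∀ j, r₀ j < Kerr.radius (a j) (poincareInv (mo j).1 (mo j).2 x)) ∧
            Kerr.radius (a i) (poincareInv (mo i).1 (mo i).2 x) ≤ R i} k
          (𝒟.toSpacetime.deviationExtend ⟨U, boostedKerrBilin (mo i).1 (mo i).2 (M i) (a i),
            fun x ↦ x 0, fun x ↦ Kerr.radius (a i) (poincareInv (mo i).1 (mo i).2 x)⟩ Φ) ≤
          ENNReal.ofReal ε) ∧
        supCkENorm {x : E4 | x 0 = τ ∧
            (∀ j, r₀ j < Kerr.radius (a j) (poincareInv (mo j).1 (mo j).2 x)) ∧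
            ∀ j, R j - 1 ≤ Kerr.radius (a j) (poincareInv (mo j).1 (mo j).2 x)} k
          (𝒟.toSpacetime.deviationExtend (Minkowski.backgroundOn U) Φ) ≤ ENNReal.ofReal ε ∧
        (∀ x : ↥U, x.1 0 = τ →
          (∀ j, R j - 1 ≤ Kerr.radius (a j) (poincareInv (mo j).1 (mo j).2 x.1)) →
          𝒟.timeOrientation.IsFutureDirected (mfderiv 𝓘(ℝ, E4) (𝓡 4) Φ x (E4.basisVector 0)))) ↔
    (∀ ε : ℝ, 0 < ε → ∃ τ : ℝ,
      ∃ (R : Fin N → ℝ) (U : Opens E4) (Φ : U → 𝒟.carrier), (∀ i, r₀ i + 1 ≤ R i) ∧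
        ContMDiff 𝓘(ℝ, E4) (𝓡 4) ∞ Φ ∧ Topology.IsOpenEmbedding Φ ∧
        {x : E4 | x 0 = τ ∧ ∀ j, r₀ j < Kerr.radius (a j) (poincareInv (mo j).1 (mo j).2 x)} ⊆
          (U : Set E4) ∧
        range Φ ⊆ 𝒟.metric.causalFuture 𝒟.timeOrientation (range 𝒟.embed) ∧
        𝒟.metric.IsAchronal 𝒟.timeOrientation (Φ '' {x : ↥U | (x : E4) 0 = τ}) ∧
        (∀ i, supCkENorm {x : E4 | x 0 = τ ∧
            (∀ j, r₀ j < Kerr.radius (a j) (poincareInv (mo j).1 (mo j).2 x)) ∧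
            Kerr.radius (a i) (poincareInv (mo i).1 (mo i).2 x) ≤ R i} k
          (𝒟.toSpacetime.deviationExtend ⟨U, boostedKerrBilin (mo i).1 (mo i).2 (M i) (a i),
            fun x ↦ x 0, fun x ↦ Kerr.radius (a i) (poincareInv (mo i).1 (mo i).2 x)⟩ Φ) ≤
          ENNReal.ofReal ε) ∧
        supCkENorm {x : E4 | x 0 = τ ∧
            (∀ j, r₀ j < Kerr.radius (a j) (poincareInv (mo j).1 (mo j).2 x)) ∧
            ∀ j, R j - 1 ≤ Kerr.radius (a j) (poincareInv (mo j).1 (mo j).2 x)} k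
          (𝒟.toSpacetime.deviationExtend (Minkowski.backgroundOn U) Φ) ≤ ENNReal.ofReal ε ∧
        (∀ x : ↥U, x.1 0 = τ →
          (∀ j, R j - 1 ≤ Kerr.radius (a j) (poincareInv (mo j).1 (mo j).2 x.1)) →
          𝒟.timeOrientation.IsFutureDirected (mfderiv 𝓘(ℝ, E4) (𝓡 4) Φ x (E4.basisVector 0)))) := by
  constructor
  · intro h ε hε
    obtain ⟨τ, -, hτ⟩ := h ε hε 0
    exact ⟨τ, hτ⟩
  · intro h ε hε τ₁
    obtain ⟨τ, hτ⟩ := h ε hε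
    exact ⟨τ₁, le_rfl, slab_anytime 𝒟 k N M a r₀ mo w s hw hw0 ε τ τ₁ hτ⟩

/-- **In particular for `N = 0` (dispersal) and `N = 1` (one hole), and for every configuration whose
holes share one Lorentz part `Λ`**: take `w = Λ∂₀` (`Λ⁻¹w = ∂₀`, and `(Λ∂₀)⁰ ≠ 0` by
`NecksCertify.Negative.lorentz_basisVector_zero_apply_zero_ne_zero`); for `N = 0` any `Λ`, e.g.
`1`, will do. So the
recurrence hypothesis of `SingleKerrEndgame`'s shape and the `N ≤ 1` instances of the crux's clause (i)
say exactly "for every `ε` some `ε`-good slab somewhere in `J⁺(ιX)`". [cite: KerrSchild1965, §2] -/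
theorem recurs_iff_exists_slab_of_eq (𝒟 : VacuumCauchyDevelopment D) (k N : ℕ)
    (M a r₀ : Fin N → ℝ) (mo : Fin N → ↥lorentzGroup × E4) (Λ : lorentzGroup)
    (hΛ : ∀ j, (mo j).1 = Λ) :
    (∀ ε : ℝ, 0 < ε → ∀ τ₁ : ℝ, ∃ τ : ℝ, τ₁ ≤ τ ∧
      ∃ (R : Fin N → ℝ) (U : Opens E4) (Φ : U → 𝒟.carrier), (∀ i, r₀ i + 1 ≤ R i) ∧
        ContMDiff 𝓘(ℝ, E4) (𝓡 4) ∞ Φ ∧ Topology.IsOpenEmbedding Φ ∧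
        {x : E4 | x 0 = τ ∧ ∀ j, r₀ j < Kerr.radius (a j) (poincareInv (mo j).1 (mo j).2 x)} ⊆
          (U : Set E4) ∧
        range Φ ⊆ 𝒟.metric.causalFuture 𝒟.timeOrientation (range 𝒟.embed) ∧
        𝒟.metric.IsAchronal 𝒟.timeOrientation (Φ '' {x : ↥U | (x : E4) 0 = τ}) ∧
        (∀ i, supCkENorm {x : E4 | x 0 = τ ∧
            (∀ j, r₀ j < Kerr.radius (a j) (poincareInv (mo j).1 (mo j).2 x)) ∧
            Kerr.radius (a i) (poincareInv (mo i).1 (mo i).2 x) ≤ R i} k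
          (𝒟.toSpacetime.deviationExtend ⟨U, boostedKerrBilin (mo i).1 (mo i).2 (M i) (a i),
            fun x ↦ x 0, fun x ↦ Kerr.radius (a i) (poincareInv (mo i).1 (mo i).2 x)⟩ Φ) ≤
          ENNReal.ofReal ε) ∧
        supCkENorm {x : E4 | x 0 = τ ∧
            (∀ j, r₀ j < Kerr.radius (a j) (poincareInv (mo j).1 (mo j).2 x)) ∧
            ∀ j, R j - 1 ≤ Kerr.radius (a j) (poincareInv (mo j).1 (mo j).2 x)} k
          (𝒟.toSpacetime.deviationExtend (Minkowski.backgroundOn U) Φ) ≤ ENNReal.ofReal ε ∧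
        (∀ x : ↥U, x.1 0 = τ →
          (∀ j, R j - 1 ≤ Kerr.radius (a j) (poincareInv (mo j).1 (mo j).2 x.1)) →
          𝒟.timeOrientation.IsFutureDirected (mfderiv 𝓘(ℝ, E4) (𝓡 4) Φ x (E4.basisVector 0)))) ↔
    (∀ ε : ℝ, 0 < ε → ∃ τ : ℝ,
      ∃ (R : Fin N → ℝ) (U : Opens E4) (Φ : U → 𝒟.carrier), (∀ i, r₀ i + 1 ≤ R i) ∧
        ContMDiff 𝓘(ℝ, E4) (𝓡 4) ∞ Φ ∧ Topology.IsOpenEmbedding Φ ∧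
        {x : E4 | x 0 = τ ∧ ∀ j, r₀ j < Kerr.radius (a j) (poincareInv (mo j).1 (mo j).2 x)} ⊆
          (U : Set E4) ∧
        range Φ ⊆ 𝒟.metric.causalFuture 𝒟.timeOrientation (range 𝒟.embed) ∧
        𝒟.metric.IsAchronal 𝒟.timeOrientation (Φ '' {x : ↥U | (x : E4) 0 = τ}) ∧
        (∀ i, supCkENorm {x : E4 | x 0 = τ ∧
            (∀ j, r₀ j < Kerr.radius (a j) (poincareInv (mo j).1 (mo j).2 x)) ∧
            Kerr.radius (a i) (poincareInv (mo i).1 (mo i).2 x) ≤ R i} k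
          (𝒟.toSpacetime.deviationExtend ⟨U, boostedKerrBilin (mo i).1 (mo i).2 (M i) (a i),
            fun x ↦ x 0, fun x ↦ Kerr.radius (a i) (poincareInv (mo i).1 (mo i).2 x)⟩ Φ) ≤
          ENNReal.ofReal ε) ∧
        supCkENorm {x : E4 | x 0 = τ ∧
            (∀ j, r₀ j < Kerr.radius (a j) (poincareInv (mo j).1 (mo j).2 x)) ∧
            ∀ j, R j - 1 ≤ Kerr.radius (a j) (poincareInv (mo j).1 (mo j).2 x)} k
          (𝒟.toSpacetime.deviationExtend (Minkowski.backgroundOn U) Φ) ≤ ENNReal.ofReal ε ∧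
        (∀ x : ↥U, x.1 0 = τ →
          (∀ j, R j - 1 ≤ Kerr.radius (a j) (poincareInv (mo j).1 (mo j).2 x.1)) →
          𝒟.timeOrientation.IsFutureDirected (mfderiv 𝓘(ℝ, E4) (𝓡 4) Φ x (E4.basisVector 0)))) :=
  recurs_iff_exists_slab 𝒟 k N M a r₀ mo ((Λ : E4 ≃L[ℝ] E4) (E4.basisVector 0)) (fun _ ↦ 1)
    (fun j ↦ by rw [hΛ j, ContinuousLinearEquiv.symm_apply_apply, one_smul])
    (NecksCertify.Negative.lorentz_basisVector_zero_apply_zero_ne_zero Λ)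

/-! ### By name: the crux already decides comoving-recurrent developments with NO lateness -/

/-- **`KillingSpinorEndgame` with the lateness quantifier deleted, for configurations sharing one
Lorentz part `Λ` (in particular `N = 0` and `N = 1`)**: the crux as typed already yields its conclusion
for every MGHD which has, for every `ε > 0`, ONE `ε`-good slab at SOME lab time (anywhere in `J⁺(ιX)`)
— by `recurs_iff_exists_slab_of_eq` such a development satisfies clause (i) verbatim. This is the
precise sense in which "recurs … beyond every lab time" is, for `N ≤ 1`, not a hypothesis a prover can
use: it is implied by its `τ₁`-free form. (Statement: the crux's text with `(Λ : lorentzGroup)`,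
`(∀ j, (mo j).1 = Λ)` added to the configuration and `∀ τ₁, ∃ τ, τ₁ ≤ τ ∧` replaced by `∃ τ,`.)
[cite: KerrSchild1965, §2] -/
theorem killingSpinorEndgame_comoving_anytime
    (h : Summit.FinalStateConjecture.FinalStateConjecture.Theses.KerrnessPropagates.KillingSpinorEndgame) :
    ∃ k : ℕ, ∀ (X : Type) [TopologicalSpace X] [ChartedSpace Literature.Geometry.Lorentzian.E3 X]
      [IsManifold (𝓡 3) (⊤ : ℕ∞) X] [T2Space X] [SecondCountableTopology X] [ConnectedSpace X] (D
      : Literature.Geometry.Lorentzian.InitialDataSet (𝓡 3) X), D ∈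
      Literature.Geometry.Lorentzian.admissibleVacuumData X → ∀ 𝒟 :
      Literature.Geometry.Lorentzian.VacuumCauchyDevelopment D, 𝒟.IsMaximal →
      Summit.FinalStateConjecture.HasCompleteNullInfinity 𝒟.toCauchyDevelopment → (∃ (N : ℕ) (M a
      r₀ : Fin N → ℝ) (mo : Fin N → ↥Literature.Geometry.Lorentzian.lorentzGroup ×
      Literature.Geometry.Lorentzian.E4) (Λ : ↥Literature.Geometry.Lorentzian.lorentzGroup), (∀ j,
      (mo j).1 = Λ) ∧ (∀ i, Literature.Geometry.Lorentzian.Kerr.IsSubextremal (M i) (a i) ∧ r₀ i ∈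
      Ioo (Literature.Geometry.Lorentzian.Kerr.rMinus (M i) (a i))
      (Literature.Geometry.Lorentzian.Kerr.rPlus (M i) (a i))) ∧ ∀ ε : ℝ, 0 < ε → ∃ τ : ℝ, ∃ (R :
      Fin N → ℝ) (U : Opens Literature.Geometry.Lorentzian.E4) (Φ : U → 𝒟.carrier), (∀ i, r₀ i + 1
      ≤ R i) ∧ ContMDiff 𝓘(ℝ, Literature.Geometry.Lorentzian.E4) (𝓡 4) (⊤ : ℕ∞) Φ ∧
      Topology.IsOpenEmbedding Φ ∧ {x : Literature.Geometry.Lorentzian.E4 | x 0 = τ ∧ (∀ j, r₀ j <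
      Literature.Geometry.Lorentzian.Kerr.radius (a j) (Literature.Geometry.Lorentzian.poincareInv
      (mo j).1 (mo j).2 x))} ⊆ (U : Set Literature.Geometry.Lorentzian.E4) ∧ range Φ ⊆
      𝒟.metric.causalFuture 𝒟.timeOrientation (range 𝒟.embed) ∧ 𝒟.metric.IsAchronal
      𝒟.timeOrientation (Φ '' {x : ↥U | (x : Literature.Geometry.Lorentzian.E4) 0 = τ}) ∧ (∀ i,
      Literature.Geometry.Lorentzian.supCkENorm {x : Literature.Geometry.Lorentzian.E4 | x 0 = τ ∧
      (∀ j, r₀ j < Literature.Geometry.Lorentzian.Kerr.radius (a j)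
      (Literature.Geometry.Lorentzian.poincareInv (mo j).1 (mo j).2 x)) ∧
      Literature.Geometry.Lorentzian.Kerr.radius (a i) (Literature.Geometry.Lorentzian.poincareInv
      (mo i).1 (mo i).2 x) ≤ R i} k (𝒟.toSpacetime.deviationExtend ⟨U,
      Literature.Geometry.Lorentzian.boostedKerrBilin (mo i).1 (mo i).2 (M i) (a i), fun x ↦ x 0,
      fun x ↦ Literature.Geometry.Lorentzian.Kerr.radius (a i)
      (Literature.Geometry.Lorentzian.poincareInv (mo i).1 (mo i).2 x)⟩ Φ) ≤ ENNReal.ofReal ε) ∧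
      Literature.Geometry.Lorentzian.supCkENorm {x : Literature.Geometry.Lorentzian.E4 | x 0 = τ ∧
      (∀ j, r₀ j < Literature.Geometry.Lorentzian.Kerr.radius (a j)
      (Literature.Geometry.Lorentzian.poincareInv (mo j).1 (mo j).2 x)) ∧ ∀ j, R j - 1 ≤
      Literature.Geometry.Lorentzian.Kerr.radius (a j) (Literature.Geometry.Lorentzian.poincareInv
      (mo j).1 (mo j).2 x)} k (𝒟.toSpacetime.deviationExtend
      (Literature.Geometry.Lorentzian.Minkowski.backgroundOn U) Φ) ≤ ENNReal.ofReal ε ∧ (∀ x : ↥U,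
      x.1 0 = τ → (∀ j, R j - 1 ≤ Literature.Geometry.Lorentzian.Kerr.radius (a j)
      (Literature.Geometry.Lorentzian.poincareInv (mo j).1 (mo j).2 x.1)) →
      𝒟.timeOrientation.IsFutureDirected (mfderiv 𝓘(ℝ, Literature.Geometry.Lorentzian.E4) (𝓡 4) Φ
      x (Literature.Geometry.Lorentzian.E4.basisVector 0)))) → (∀ (O : Set 𝒟.carrier) (d :
      Literature.Geometry.Lorentzian.FinalStateDecomposition 𝒟.toSpacetime O 2), (∀ i,
      Literature.Geometry.Lorentzian.Kerr.IsSubextremal (d.mass i) (d.spin i)) → O =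
      Summit.FinalStateConjecture.exteriorOf 𝒟.toCauchyDevelopment d.charted →
      Summit.FinalStateConjecture.HasExhaustiveCharts d →
      Summit.FinalStateConjecture.IsFutureOriented d →
      Summit.FinalStateConjecture.RaysStayInClosure 𝒟.toCauchyDevelopment O) → ∃ (O : Set
      𝒟.carrier) (d : Literature.Geometry.Lorentzian.FinalStateDecomposition 𝒟.toSpacetime O 2),
      (∀ i, Literature.Geometry.Lorentzian.Kerr.IsSubextremal (d.mass i) (d.spin i)) ∧ O =
      Summit.FinalStateConjecture.exteriorOf 𝒟.toCauchyDevelopment d.charted ∧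
      Summit.FinalStateConjecture.RaysStayInClosure 𝒟.toCauchyDevelopment O ∧
      Summit.FinalStateConjecture.HasExhaustiveCharts d ∧
      Summit.FinalStateConjecture.IsFutureOriented d := by
  obtain ⟨k, hk⟩ := h
  refine ⟨k, ?_⟩
  intro X _ _ _ _ _ _ D hD 𝒟 hmax hI hrec hii
  obtain ⟨N, M, a, r₀, mo, Λ, hΛ, hcfg, hslab⟩ := hrec
  exact hk X D hD 𝒟 hmax hI
    ⟨N, M, a, r₀, mo, hcfg, (recurs_iff_exists_slab_of_eq 𝒟 k N M a r₀ mo Λ hΛ).2 hslab⟩ hii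

end Consequences

end Summit.FinalStateConjecture.FinalStateConjecture.Theorems.KillingSpinorEndgame.Negative
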